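import Summits.KontsevichZagierPeriods.KontsevichZagierPeriods.Theorems.HurwitzMicroSectorsNormalFormPrincipleL2W3Carriers
import Summits.KontsevichZagierPeriods.KontsevichZagierPeriods.Theorems.HurwitzMicroSectorsNormalFormPrincipleL2W3ExistsChartTargets
import Summits.KontsevichZagierPeriods.KontsevichZagierPeriods.Theorems.HurwitzMicroSectorsNormalFormPrincipleM3EbdBoxSubSimplex
import Summits.KontsevichZagierPeriods.KontsevichZagierPeriods.Theorems.HurwitzMicroSectorsNormalFormPrincipleL2W3RelationsDilation
import Summits.KontsevichZagierPeriods.KontsevichZagierPeriods.Theorems.HurwitzMicroSectorsNormalFormPrincipleL2W3RelationsMoebiusOne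
import Summits.KontsevichZagierPeriods.KontsevichZagierPeriods.Theorems.HurwitzMicroSectorsNormalFormPrincipleL2W3RelationsMoebiusTwo
import Summits.KontsevichZagierPeriods.KontsevichZagierPeriods.Theorems.HurwitzMicroSectorsNormalFormPrincipleL2W3RelationsMoebiusThree
import Summits.KontsevichZagierPeriods.KontsevichZagierPeriods.Theorems.HurwitzMicroSectorsNormalFormPrincipleL2W3RelationsReflection
import Summits.KontsevichZagierPeriods.KontsevichZagierPeriods.Theorems.HurwitzMicroSectorsNormalFormPrincipleL2W3BoxSubPrism
import Summits.KontsevichZagierPeriods.KontsevichZagierPeriods.Theorems.HurwitzMicroSectorsNormalFormPrincipleL2W3RelationShuffle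
import Literature.NumberTheory.Transcendental.KZSubcalculusInvariants

/-!
# `NormalFormPrinciple` (stmt-KontsevichZagierPeriods-3869), line `SketchIdeator1` —
# leaf `stub_boxRigidity` in DIMENSION THREE: HalfPointZetaTwoLogTwo `[(0,1)³, 4/((2−x)(1−xyz))] ∼ [(0,1)³, 3/((1−xy)(1+z))]`

Assembly file (layer `L2W3`, lead seat c9; `--supports` the crux) of the last target of the crux idea
`m3-equal-value-instances` (strategist gen 2): `4∫dV/((2−x)(1−xyz)) = 3ζ(2)log 2`, the right side being
the PRODUCT box `[(0,1)², 3/(1−xy)] × [(0,1), 1/(1+z)]`. Chain: the simplex chart gives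
`2[aab] + 2[dab]`; the prism chart `(x, xy, z)` and the SHUFFLE dissection of the prism give
`3([abc] + [acb] + [cab])`; one reflection converts `[dab] = [abc]`; and
`2[aab] − [abc] − 3[acb] − 3[cab] = rel1 − rel2 + 5rel5 − 2rel6 + 2rel8 + 4rel9 + relS`, where `relS`
(`4[acc] + 2[cac] = [abc] + [acb] + [cab]`, two shuffles and one partial dilation of the prism) is the
only place where the evaluation `(∫c)(∫ac) = ½(∫c)(∫ab) = ½ζ(2)log 2` enters; it also yields the classical
`∫₀¹ Li₂(t)/(1+t) dt = ζ(2)log 2 − (5/8)ζ(3)` inside the calculus. No independence input.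
Sources: M. Kontsevich, D. Zagier, *Periods* (2001), §1.2; K. Ihara, M. Kaneko, D. Zagier, Compos.
Math. 142 (2006), §1 (double shuffle). No definitions are introduced.
-/

noncomputable section

open MeasureTheory Set
open Literature.NumberTheory.Transcendental Literature.NumberTheory.Transcendental.KZ
open Literature.ModelTheory.ExponentialFields (IsSemialgebraic)
open Summit.KontsevichZagierPeriods.HyperbolicBloch.OffTetraSectorKernel
  (aff_orbit_of_sub_sum_zsmul_mem_relations)

namespace Summit.KontsevichZagierPeriods.HurwitzMicroSectors.NormalFormPrinciple.PiBox.M3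

/-- **HalfPointZetaTwoLogTwo (`StrategistGen2.HalfPointZetaTwoLogTwo`, crux idea `m3-equal-value-instances`;
registered sub-goal of stmt-KontsevichZagierPeriods-3869, line `SketchIdeator1`, layer `L2W3`).** Any
representation of `[(0,1)³, 4/((2−x)(1−xyz))]` is KZ-equivalent to any representation of the PRODUCT box
`[(0,1)³, 3/((1−xy)(1+z))]` (`= 3ζ(2)·log 2`): the simplex chart gives `2[aab] + 2[dab]`, the prism chart and
the shuffle dissection give `3([abc] + [acb] + [cab])`; one reflection converts `[dab] = [abc]`, and
`2[aab] − [abc] − 3[acb] − 3[cab] = rel1 − rel2 + 5rel5 − 2rel6 + 2rel8 + 4rel9 + relS` (dilation, Möbius, duality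
moves and the shuffle relation — the only place where the value `ζ(2)·log 2` enters).
[cite: KontsevichZagier2001, §1.2 rules (1), (2)] -/
theorem halfPointZetaTwoLogTwo (r r' : IntegralRep 3)
    (hrd : r.domain = {x | ∀ i, x i ∈ Set.Ioo (0:ℝ) 1})
    (hri : EqOn r.integrand (fun x => 4 / ((2 - x 0) * (1 - x 0 * x 1 * x 2))) {x | ∀ i, x i ∈ Set.Ioo (0:ℝ) 1})
    (hr'd : r'.domain = {x | ∀ i, x i ∈ Set.Ioo (0:ℝ) 1})
    (hr'i : EqOn r'.integrand (fun x => 3 / ((1 - x 0 * x 1) * (1 + x 2))) {x | ∀ i, x i ∈ Set.Ioo (0:ℝ) 1}) :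
    Equivalent r r' := by
  obtain ⟨AAB, ABB, AAC, ACC, ABC, ACB, CBB, CBC, CCB, CCC, CAB, CAC, AAD, DAD, ADD, DAB,
    ⟨hAABd, hAABi⟩, ⟨hABBd, hABBi⟩, ⟨hAACd, hAACi⟩, ⟨hACCd, hACCi⟩, ⟨hABCd, hABCi⟩, ⟨hACBd, hACBi⟩,
    ⟨hCBBd, hCBBi⟩, ⟨hCBCd, hCBCi⟩, ⟨hCCBd, hCCBi⟩, ⟨hCCCd, hCCCi⟩, ⟨hCABd, hCABi⟩, ⟨hCACd, hCACi⟩,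
    ⟨hAADd, hAADi⟩, ⟨hDADd, hDADi⟩, ⟨hADDd, hADDi⟩, ⟨hDABd, hDABi⟩⟩ := l2w3_carriers
  obtain ⟨⟨G1, hG1d, hG1i⟩, ⟨G2, hG2d, hG2i⟩, ⟨G3, hG3d, hG3i⟩, ⟨G4, hG4d, hG4i⟩, ⟨G5, hG5d, hG5i⟩,
    ⟨G6, hG6d, hG6i⟩⟩ := l2w3_exists_chartTargets
  have e0 : of r - of G6 ∈ relations := by
    refine ebd_box_sub_simplex (fun t => 4 / (t 0 * (2 - t 0) * t 1 * (1 - t 2))) r G6 hrd hG6d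
      (hG6i ▸ fun _ _ => rfl) fun x hx => ?_
    have hx' : ∀ i, x i ∈ Set.Ioo (0:ℝ) 1 := by rw [hrd] at hx; exact hx
    have h0 : x 0 ≠ 0 := (hx' 0).1.ne'
    have h1 : x 1 ≠ 0 := (hx' 1).1.ne'
    have h012m : 1 - x 0 * x 1 * x 2 ≠ 0 := by
      have := mul_lt_one_of_nonneg_of_lt_one_left (mul_pos (hx' 0).1 (hx' 1).1).le
        (mul_lt_one_of_nonneg_of_lt_one_left (hx' 0).1.le (hx' 0).2 (hx' 1).2.le) (hx' 2).2.le
      exact (sub_pos.2 this).ne'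
    have h2x : 2 - x 0 ≠ 0 := by linarith [(hx' 0).2]
    rw [hri hx']
    simp only [Matrix.cons_val_zero, Matrix.cons_val_one, Matrix.cons_val_two, Matrix.head_cons,
      Matrix.tail_cons]
    field_simp
  have e0' : of G6 - ((2:ℤ) • of AAB + (2:ℤ) • of DAB) ∈ relations := by
    have h := aff_orbit_of_sub_sum_zsmul_mem_relations (Finset.univ : Finset (Fin 2))
      ![AAB, DAB] ![2, 2] G6 (fun i _ => by
        fin_cases i
        · exact hAABd.trans hG6d.symm
        · exact hDABd.trans hG6d.symm) fun t ht => ?_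
    · simpa [Fin.sum_univ_two, add_assoc] using h
    have hf := l2v_simplex_facts (hG6d ▸ ht)
    simp only [Fin.sum_univ_two, Matrix.cons_val_zero, Matrix.cons_val_one, hG6i, hAABi, hDABi]
    have h0 : t 0 ≠ 0 := hf.1.ne'
    have h0a : 1 - t 0 ≠ 0 := by linarith [hf.2.1]
    have h0b : 1 + t 0 ≠ 0 := by linarith [hf.1]
    have h0c : 2 - t 0 ≠ 0 := by linarith [hf.2.1]
    have h1 : t 1 ≠ 0 := hf.2.2.1.ne'
    have h1a : 1 - t 1 ≠ 0 := by linarith [hf.2.2.2.1]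
    have h1b : 1 + t 1 ≠ 0 := by linarith [hf.2.2.1]
    have h1c : 2 - t 1 ≠ 0 := by linarith [hf.2.2.2.1]
    have h2a : 1 - t 2 ≠ 0 := by linarith [hf.2.2.2.2.2]
    have h2b : 1 + t 2 ≠ 0 := by linarith [hf.2.2.2.2.1]
    have h2c : 2 - t 2 ≠ 0 := by linarith [hf.2.2.2.2.2]
    push_cast
    field_simp
    ring
  -- the RHS product box onto the prism, and the two prism carriers
  obtain ⟨hprism, hexP⟩ := l2w3_box_sub_prism
  obtain ⟨⟨PABC, hPABCd, hPABCi⟩, ⟨PACC, hPACCd, hPACCi⟩⟩ := hexP r' hr'd (hr'd ▸ hr'i)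
  have e1 : of r' - of (PABC.constMul ((3:ℕ) : ℝ) (isAlgebraic_nat 3)) ∈ relations := by
    refine hprism (fun t => ((3:ℕ) : ℝ) * (1 / t 0 * (1 / (1 - t 1)) * (1 / (1 + t 2)))) r'
      (PABC.constMul ((3:ℕ) : ℝ) (isAlgebraic_nat 3)) hr'd
      (by rw [IntegralRep.domain_constMul]; exact hPABCd)
      (fun t _ => by rw [IntegralRep.integrand_constMul, hPABCi]) fun x hx => ?_
    have hx' : ∀ i, x i ∈ Set.Ioo (0:ℝ) 1 := by rw [hr'd] at hx; exact hx
    have h0 : x 0 ≠ 0 := (hx' 0).1.ne'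
    have h01 : 1 - x 0 * x 1 ≠ 0 :=
      (sub_pos.2 (mul_lt_one_of_nonneg_of_lt_one_left (hx' 0).1.le (hx' 0).2 (hx' 1).2.le)).ne'
    have h2 : 1 + x 2 ≠ 0 := by linarith [(hx' 2).1]
    rw [hr'i hx']
    simp only [Matrix.cons_val_zero, Matrix.cons_val_one, Matrix.cons_val_two, Matrix.head_cons,
      Matrix.tail_cons]
    push_cast
    field_simp
  have e1' : of (PABC.constMul ((3:ℕ) : ℝ) (isAlgebraic_nat 3)) - 3 • of PABC ∈ relations :=
    PABC.of_constMul_nat_sub_nsmul_mem_relations 3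
  obtain ⟨shuf, relS⟩ := l2w3_relation_shuffle PABC PACC ABC ACB CAB ACC CAC hPABCd hPABCi hPACCd hPACCi
    hABCd hABCi hACBd hACBi hCABd hCABi hACCd hACCi hCACd hCACi
  have rel1 : (3:ℤ) • of AAB - (4:ℤ) • of AAC ∈ relations :=
    l2w3_relations_dilation.1 AAB hAABd hAABi AAC hAACd hAACi
  have rel2 : of ABB - (2:ℤ) • of ABC - (2:ℤ) • of ACB + (2:ℤ) • of ACC ∈ relations :=
    l2w3_relations_dilation.2 ABB hABBd hABBi ABC hABCd hABCi ACB hACBd hACBi ACC hACCd hACCi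
  have rel5 : of ABB - of AAB ∈ relations := l2w3_relations_reflection.1 AAB hAABd hAABi ABB hABBd hABBi
  have rel6 : of CCB + of CCC - of ACC ∈ relations :=
    l2w3_relations_moebius_two.1 ACC hACCd hACCi CCB hCCBd hCCBi CCC hCCCd hCCCi
  have rel8 : of CAB + of CAC - of CCB - of CCC - of ABC ∈ relations :=
    l2w3_relations_moebius_two.2.2 ABC hABCd hABCi CAB hCABd hCABi CAC hCACd hCACi CCB hCCBd hCCBi CCC hCCCd hCCCi
  have rel9 : of AAB + of AAC - of ACB - of ACC - of CAB - of CAC + of CCB + of CCC - of ABB ∈ relations :=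
    l2w3_relations_moebius_three ABB hABBd hABBi AAB hAABd hAABi AAC hAACd hAACi ACB hACBd hACBi ACC hACCd hACCi
      CAB hCABd hCABi CAC hCACd hCACi CCB hCCBd hCCBi CCC hCCCd hCCCi
  have conv4 : of DAB - of ABC ∈ relations := l2w3_relations_reflection.2.2.2.2 ABC hABCd hABCi DAB hDABd hDABi
  have key : ((2:ℤ) • of AAB + (2:ℤ) • of DAB) - 3 • of PABC =
      (2:ℤ) • (of DAB - of ABC) - 3 • (of PABC - of ABC - of ACB - of CAB)
      + (((3:ℤ) • of AAB - (4:ℤ) • of AAC)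
        - (of ABB - (2:ℤ) • of ABC - (2:ℤ) • of ACB + (2:ℤ) • of ACC)
        + (5:ℤ) • (of ABB - of AAB)
        - (2:ℤ) • (of CCB + of CCC - of ACC)
        + (2:ℤ) • (of CAB + of CAC - of CCB - of CCC - of ABC)
        + (4:ℤ) • (of AAB + of AAC - of ACB - of ACC - of CAB - of CAC + of CCB + of CCC - of ABB)
        + ((4:ℤ) • of ACC + (2:ℤ) • of CAC - of ABC - of ACB - of CAB)) := by
    simp only [smul_sub, smul_add]
    abel
  have hmid : ((2:ℤ) • of AAB + (2:ℤ) • of DAB) - 3 • of PABC ∈ relations := by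
    rw [key]
    refine relations.add_mem (relations.sub_mem (relations.zsmul_mem conv4 2) (relations.nsmul_mem shuf 3)) ?_
    exact relations.add_mem (relations.add_mem (relations.add_mem (relations.sub_mem (relations.add_mem
      (relations.sub_mem rel1 rel2) (relations.zsmul_mem rel5 5)) (relations.zsmul_mem rel6 2))
      (relations.zsmul_mem rel8 2)) (relations.zsmul_mem rel9 4)) relS
  have e : of r - of r' = (of r - of G6) + (of G6 - ((2:ℤ) • of AAB + (2:ℤ) • of DAB))
      + (((2:ℤ) • of AAB + (2:ℤ) • of DAB) - 3 • of PABC)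
      - (of (PABC.constMul ((3:ℕ) : ℝ) (isAlgebraic_nat 3)) - 3 • of PABC)
      - (of r' - of (PABC.constMul ((3:ℕ) : ℝ) (isAlgebraic_nat 3))) := by abel
  show of r - of r' ∈ relations
  rw [e]
  exact relations.sub_mem (relations.sub_mem (relations.add_mem (relations.add_mem e0 e0') hmid) e1') e1

end Summit.KontsevichZagierPeriods.HurwitzMicroSectors.NormalFormPrinciple.PiBox.M3
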